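import Summits.Ventures.CertifiedManyBodySolver.Theorems.TcThermcert1GibbsCurrentFormula
import Summits.Ventures.CertifiedManyBodySolver.Observables.StiffnessThermalLeaf
import Literature.MathematicalPhysics.QuantumLattice.HubbardNNNHoppingFlux
import Mathlib
import HarnessLib

/-!
# Twist cost of the sector free energy of the flux torus from a bound on the seam current

Helper module for route `TcThermcert1`, cruxes K1′ `ThermalStiffnessCeilingU8b8_le_7o44` (item `stmt-Ventures-24560`)
and K1 `ThermalStiffnessCeilingU8b10_le_1o8` (item `stmt-Ventures-26381`), line
`Cruxes/ThermalStiffnessCeilingU8b10_le_1o8/Lines/gauge_qbp_far_seam.lean`, stub A (`stub_twistCost_of_farCutCurrent`).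
This file is the MODEL-SPECIFIC CALCULUS HALF of that stub, on top of the model-free engine
`Theorems/TcThermcert1GibbsCurrentFormula.lean`:

* §1 `isHermitian_of_hasDerivAt`: the derivative of a Hermitian matrix family is Hermitian (closedness); `toBlock_sum`;
  `gibbsState_toBlock_eq_of_smul_commutator_eq_sub`: relocation by stationarity, `c•[H,N] = J₁ − J₂`, `N` block-diagonal ⇒ `⟨J₁|_p⟩ = ⟨J₂|_p⟩`.
No definitions (theorems only).
* §2 `hasDerivAt_seamTwist`: `∂_θ seamTwist L θ =` the explicit phase-dressed seam current operator (a triple sum; no new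
  definition is made in `Theorems/` — line files name it `seamCurrentOp`), `isHermitian_of_hasDerivAt_seamTwist`;
  `hubbardTorusTT'Flux L 0 U φ = hubbardTorusTT' L 1 0 U + seamTwist L φ`; and the twist-cost bound, for ANY flux derivative `J`
  of `seamTwist L` and ANY coordinate sector `p`: a bound `|Re⟨(J φ)|_p⟩_{β, H_L(φ)|_p}| ≤ η` on `|φ| ≤ θ₁` gives
  `|log Re Z_p(0) − log Re Z_p(θ)| ≤ β η θ₁` for `|θ| ≤ θ₁` (`abs_log_partitionFn_fluxBlock_sub_le`), in particular for the
  route observable `thermalFluxLogZ L 0 U δ β` (`abs_thermalFluxLogZ_sub_le_of_seamCurrent_bound`).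

What is NOT here (the other half of stub A, and stubs B, C): the stationarity identity relocating `Re⟨∂_φ seamTwist⟩`
to the plain current through a far cut, the Capel–Moscolari–Teufel–Wessel port, the clustering hypothesis.
All statements are finite-dimensional folklore; nothing about superconductivity in the Hubbard model is proved by
anything in this file.
-/

noncomputable section

open scoped Matrix.Norms.L2Operator ComplexOrder ComplexConjugate
open Filter Topology NormedSpace Asymptotics Matrix
open Literature.MathematicalPhysics.QuantumLattice
open Summit.Ventures.CertifiedManyBodySolver.Observables

namespace Summit.Ventures.CertifiedManyBodySolver.Theorems.TcThermcert1.GaugeQbpFarSeam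

variable {m : Type*} [Fintype m] [DecidableEq m]

/-! ## §1 Derivatives of Hermitian families -/

/-- **Derivatives of Hermitian families are Hermitian** (the Hermitian matrices form a closed set and the
derivative is a limit of real multiples of differences). [folklore] -/
theorem isHermitian_of_hasDerivAt {W : ℝ → Matrix m m ℂ} {W' : Matrix m m ℂ} {t₀ : ℝ}
    (hW : ∀ t, (W t).IsHermitian) (hd : HasDerivAt W W' t₀) : W'.IsHermitian := by
  have ht := hd.tendsto_slope_zero
  have hclosed : IsClosed {M : Matrix m m ℂ | Mᴴ = M} :=
    isClosed_eq continuous_id.matrix_conjTranspose continuous_id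
  exact hclosed.mem_of_tendsto ht
    (Eventually.of_forall fun t => isHermitian_real_smul ((hW (t₀ + t)).sub (hW t₀)) t⁻¹)

omit [Fintype m] [DecidableEq m] in
/-- `toBlock` commutes with finite sums. [folklore] -/
theorem toBlock_sum {ι : Type*} (p q : m → Prop) (s : Finset ι) (f : ι → Matrix m m ℂ) :
    (∑ i ∈ s, f i).toBlock p q = ∑ i ∈ s, (f i).toBlock p q := by
  ext a b
  simp [Matrix.toBlock_apply, Matrix.sum_apply]

/-- **Relocation by stationarity.** If `c • (H N − N H) = J₁ − J₂` for an `N` whose off-diagonal `p`-blocks vanish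
(e.g. `N` diagonal: a partial particle number), then `J₁` and `J₂` have the same compressed Gibbs expectation
`⟨J₁|_p⟩_{β,H|_p} = ⟨J₂|_p⟩_{β,H|_p}` (from `⟨([H,N])|_p⟩ = 0`, `gibbsState_toBlock_commutator_eq_zero`). This is the
form in which stub A′ of line `gauge_qbp_far_seam` consumes the Heisenberg identity
`i[H_L(φ), N_S] = Σ_y bondCurrent L X y − seamCurrentOp L φ`. [folklore] -/
theorem gibbsState_toBlock_eq_of_smul_commutator_eq_sub (p : m → Prop) [DecidablePred p] (β : ℝ)
    (H : Matrix m m ℂ) {N J₁ J₂ : Matrix m m ℂ} (c : ℂ)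
    (hN : ∀ s t, p s → ¬ p t → N s t = 0 ∧ N t s = 0) (h : c • (H * N - N * H) = J₁ - J₂) :
    gibbsState β (H.toBlock p p) (J₁.toBlock p p) = gibbsState β (H.toBlock p p) (J₂.toBlock p p) := by
  have h0 := gibbsState_toBlock_commutator_eq_zero p β H hN
  have h1 : gibbsState β (H.toBlock p p) ((c • (H * N - N * H)).toBlock p p) = 0 := by
    have : (c • (H * N - N * H)).toBlock p p = c • (H * N - N * H).toBlock p p := rfl
    rw [this, map_smul, h0, smul_zero]
  rw [h] at h1
  have : (J₁ - J₂).toBlock p p = J₁.toBlock p p - J₂.toBlock p p := rfl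
  rwa [this, map_sub, sub_eq_zero] at h1

/-! ## §2 The seam family of the `t–U` flux torus and the twist cost of a sector free energy -/

section Seam

open Literature.Probability.LatticeModels

variable (L : ℕ) [NeZero L]

omit [NeZero L] in
/-- `d/dθ (1 − e^{aθ}) = −a e^{aθ}` along the real line. [folklore] -/
theorem hasDerivAt_one_sub_cexp (a : ℂ) (θ₀ : ℝ) :
    HasDerivAt (fun θ : ℝ => 1 - Complex.exp (a * θ)) (-a * Complex.exp (a * θ₀)) θ₀ := by
  have h1 : HasDerivAt (fun θ : ℝ => a * (θ : ℂ)) a θ₀ := by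
    simpa using (Complex.ofRealCLM.hasDerivAt (x := θ₀)).const_mul a
  exact ((hasDerivAt_const θ₀ (1 : ℂ)).sub h1.cexp).congr_deriv (by ring)

/-- **The seam twist is differentiable in the flux; its derivative is the (phase-dressed) seam CURRENT operator**
`∂_θ seamTwist L θ = Σ_{y,σ,b} (−s_b i e^{s_b iθ}) c†_{…σ} c_{…σ}` (`s_b = ±1` the orientation; at `θ = 0` the plain paramagnetic current
`Σ_{y,σ} (−i c†_{(0,y)σ} c_{(−1,y)σ} + i c†_{(−1,y)σ} c_{(0,y)σ})` through the cut `{x₁ = −1} | {x₁ = 0}`). Stated with the explicit sum (no new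
definition in `Theorems/`); line files may name it (`seamCurrentOp`). [folklore] -/
theorem hasDerivAt_seamTwist (θ₀ : ℝ) :
    HasDerivAt (fun θ : ℝ => seamTwist L θ)
      (∑ y : ZMod L, ∑ σ : Fin 2, ∑ b : Bool,
        (-((if b then 1 else -1) * Complex.I) * Complex.exp ((if b then 1 else -1) * Complex.I * θ₀)) •
          (creation (orb (FermionTorus.ofTorusSite ![if b then 0 else -1, y]) σ) *
            annihilation (orb (FermionTorus.ofTorusSite ![if b then -1 else 0, y]) σ))) θ₀ := by
  simp only [seamTwist_eq]
  apply HasDerivAt.fun_sum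
  intro y _
  apply HasDerivAt.fun_sum
  intro σ _
  apply HasDerivAt.fun_sum
  intro b _
  exact (hasDerivAt_one_sub_cexp ((if b then 1 else -1) * Complex.I) θ₀).smul_const _

/-- Any flux derivative of the seam twist is Hermitian (derivative of the Hermitian family `seamTwist L`). [folklore] -/
theorem isHermitian_of_hasDerivAt_seamTwist {J : Matrix (Finset (Orb (FermionTorus 2 L))) (Finset (Orb (FermionTorus 2 L))) ℂ}
    {θ : ℝ} (hJ : HasDerivAt (fun θ : ℝ => seamTwist L θ) J θ) : J.IsHermitian :=
  isHermitian_of_hasDerivAt (isHermitian_seamTwist L) hJ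

/-- At `t′ = 0` the `t–t′` flux torus is the `t–U` torus plus the seam twist. [folklore] -/
theorem hubbardTorusTT'Flux_zero_tp (U φ : ℝ) :
    hubbardTorusTT'Flux L 0 U φ = hubbardTorusTT' L 1 0 U + seamTwist L φ := by
  rw [hubbardTorusTT'Flux, Complex.ofReal_zero, zero_smul, add_zero]

/-- **Twist cost of a sector free energy from a bound on the seam current** (any coordinate sector `p`; `J` = any
flux derivative of `seamTwist L`, e.g. the explicit sum of `hasDerivAt_seamTwist`):
if `|Re⟨(J φ)|_p⟩_{β, H_L(φ)|_p}| ≤ η` for `|φ| ≤ θ₁` (`H_L(φ) = hubbardTorusTT'Flux L 0 U φ`, `0 ≤ β`), then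
`|log Re Z_p(0) − log Re Z_p(θ)| ≤ β η θ₁` for `|θ| ≤ θ₁` (§3 along the block family; an empty sector gives `0 ≤ βηθ₁`).
This is the model-specific calculus half of stub A of line `gauge_qbp_far_seam`; the other half (stationarity:
`Re⟨(∂_φ seamTwist)|_p⟩ =` the plain current through a far cut) is not proved here. [folklore] -/
theorem abs_log_partitionFn_fluxBlock_sub_le
    {J : ℝ → Matrix (Finset (Orb (FermionTorus 2 L))) (Finset (Orb (FermionTorus 2 L))) ℂ}
    (hJ : ∀ θ : ℝ, HasDerivAt (fun θ : ℝ => seamTwist L θ) (J θ) θ) {U β : ℝ} (hβ : 0 ≤ β)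
    (p : Finset (Orb (FermionTorus 2 L)) → Prop) [DecidablePred p] {θ₁ η : ℝ}
    (hη : ∀ φ : ℝ, |φ| ≤ θ₁ →
      |(gibbsState β ((hubbardTorusTT'Flux L 0 U φ).toBlock p p) ((J φ).toBlock p p)).re| ≤ η)
    {θ : ℝ} (hθ : |θ| ≤ θ₁) :
    |Real.log (partitionFn β ((hubbardTorusTT'Flux L 0 U 0).toBlock p p)).re
      - Real.log (partitionFn β ((hubbardTorusTT'Flux L 0 U θ).toBlock p p)).re| ≤ β * η * θ₁ := by
  have hθ₁ : 0 ≤ θ₁ := (abs_nonneg θ).trans hθ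
  have hη0 : 0 ≤ η := (abs_nonneg _).trans (hη θ hθ)
  set Hb : Matrix {a // p a} {a // p a} ℂ := (hubbardTorusTT' L 1 0 U).toBlock p p with hHb
  set W : ℝ → Matrix {a // p a} {a // p a} ℂ := fun φ => (seamTwist L φ).toBlock p p with hWdef
  set W' : ℝ → Matrix {a // p a} {a // p a} ℂ := fun φ => (J φ).toBlock p p with hW'def
  have hsplit : ∀ φ, (hubbardTorusTT'Flux L 0 U φ).toBlock p p = Hb + W φ := by
    intro φ
    rw [hubbardTorusTT'Flux_zero_tp]
    rfl
  rcases isEmpty_or_nonempty {a // p a} with hE | hN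
  · have hZ : ∀ M : Matrix {a // p a} {a // p a} ℂ, partitionFn β M = 0 := by
      intro M
      simp [partitionFn, Matrix.trace]
    rw [hZ, hZ, sub_self, abs_zero]
    exact mul_nonneg (mul_nonneg hβ hη0) hθ₁
  · have hH : Hb.IsHermitian := (hubbardTorusTT'_isHermitian L 1 0 U).submatrix Subtype.val
    have hW : ∀ t, (W t).IsHermitian := fun t => (isHermitian_seamTwist L t).submatrix Subtype.val
    have hd : ∀ t, HasDerivAt W (W' t) t := fun t => hasDerivAt_toBlock p p (hJ t)
    have hW' : ∀ t, (W' t).IsHermitian := fun t => isHermitian_of_hasDerivAt hW (hd t)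
    have hη' : ∀ t : ℝ, |t| ≤ θ₁ → |(gibbsState β (Hb + W t) (W' t)).re| ≤ η := by
      intro t ht
      rw [← hsplit]
      exact hη t ht
    have key := abs_log_partitionFn_sub_le_of_gibbsState_bound' hH hW hW' hd hβ hη' hθ
    rwa [← hsplit, ← hsplit] at key

/-- **Twist cost of `thermalFluxLogZ` from a seam-current bound** — the same in the `(N_L, S^z = 0)` sector of the
route's observable: if `|Re⟨(J φ)|_p⟩_{β, H_L(φ)|_p}| ≤ η` for `|φ| ≤ θ₁` (`J` a flux derivative of `seamTwist L`) then
`|thermalFluxLogZ L 0 U δ β 0 − thermalFluxLogZ L 0 U δ β θ| ≤ β η θ₁` for `|θ| ≤ θ₁`. [folklore] -/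
theorem abs_thermalFluxLogZ_sub_le_of_seamCurrent_bound
    {J : ℝ → Matrix (Finset (Orb (FermionTorus 2 L))) (Finset (Orb (FermionTorus 2 L))) ℂ}
    (hJ : ∀ θ : ℝ, HasDerivAt (fun θ : ℝ => seamTwist L θ) (J θ) θ) {U δ β : ℝ} (hβ : 0 ≤ β) {θ₁ η : ℝ}
    (hη : ∀ φ : ℝ, |φ| ≤ θ₁ →
      |(gibbsState β
          ((hubbardTorusTT'Flux L 0 U φ).toBlock
            (fun s : Finset (Orb (FermionTorus 2 L)) =>
              s.card = 2 * ⌊(1 - δ) * (L : ℝ) ^ 2 / 2⌋₊ ∧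
                2 * (s.filter fun i => (ofLex i).2 = 0).card = 2 * ⌊(1 - δ) * (L : ℝ) ^ 2 / 2⌋₊)
            (fun s : Finset (Orb (FermionTorus 2 L)) =>
              s.card = 2 * ⌊(1 - δ) * (L : ℝ) ^ 2 / 2⌋₊ ∧
                2 * (s.filter fun i => (ofLex i).2 = 0).card = 2 * ⌊(1 - δ) * (L : ℝ) ^ 2 / 2⌋₊))
          ((J φ).toBlock
            (fun s : Finset (Orb (FermionTorus 2 L)) =>
              s.card = 2 * ⌊(1 - δ) * (L : ℝ) ^ 2 / 2⌋₊ ∧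
                2 * (s.filter fun i => (ofLex i).2 = 0).card = 2 * ⌊(1 - δ) * (L : ℝ) ^ 2 / 2⌋₊)
            (fun s : Finset (Orb (FermionTorus 2 L)) =>
              s.card = 2 * ⌊(1 - δ) * (L : ℝ) ^ 2 / 2⌋₊ ∧
                2 * (s.filter fun i => (ofLex i).2 = 0).card = 2 * ⌊(1 - δ) * (L : ℝ) ^ 2 / 2⌋₊))).re| ≤ η)
    {θ : ℝ} (hθ : |θ| ≤ θ₁) :
    |thermalFluxLogZ L 0 U δ β 0 - thermalFluxLogZ L 0 U δ β θ| ≤ β * η * θ₁ := by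
  unfold thermalFluxLogZ
  exact abs_log_partitionFn_fluxBlock_sub_le L hJ hβ _ hη hθ

end Seam

end Summit.Ventures.CertifiedManyBodySolver.Theorems.TcThermcert1.GaugeQbpFarSeam
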